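/-
Copyright (c) 2026 the pub-hodgecm-mathlib formalisation cell (harness21).  Prover seat hodgecm-mathlib-A-p12 (g22), 2026-09-01.  Road «S3-tree» (architect A-p16 (g30)
A-152): R2² sub-head (D1) «ONE-PLACE DATA OF A TYPE-(2) MATCH» for the R2² holder A-p19 (g26) ((D3) ★ `TypeTwoCommutantBridge`, (D4) the row) — part 2∕2, the CM assembly.
-/
import Literature.NumberTheory.Rogawski1990.DepthZeroKappaTransferTypeTwoGSide     -- ★ p846592 (this seat): the type-(2) frame currency (imports the κ-eigenvector reading, the norm-pair API, the deepness lemmas)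
import Literature.NumberTheory.Rogawski1990.TypeTwoCayleyShiftCM                   -- ★ `map_finGammaTwo_mul_finGammaTwo`, `transpose_map_fst_evalRingHom_mul`
import Literature.NumberTheory.Rogawski1990.UnitaryTwoTypeTwoEdgeCount               -- ★ `placeForm_antidiagTwo_eq_antidiag`
import Literature.NumberTheory.LocalFields.InertPlaceSkewDiscriminantRoot            -- ★ `exists_mul_galAdicCompletionMap_mul_eq_one_of_even` (F0P2-p06 (g11))
import Literature.NumberTheory.Rogawski1990.UnitaryVertexStabilizerCoverCM           -- ★ `placeForm_map_transpose_of_hermitian`, `galAdicCompletionMap_involutive`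
import Literature.NumberTheory.Rogawski1990.TypeTwoOnePlaceDataAlgebra              -- (D1) part 1∕2 (this seat): the generic algebra (torus identities, cubic tokens, cyclic vector, non-isotropy)
import HarnessLib

/-!
# (D1) One-place data of a type-(2) match: `u, t, D`, the factorised characteristic polynomial, a cyclic vector, a `u`-eigenvector and the reading of `κ_v`
(Rogawski (1990) §4.9 Lemma 4.9.3 p. 56, §4.3 (4.3.2) p. 43, §3.5 Prop. 3.5.2 (c) p. 29)

Topic `NumberTheory/Rogawski1990`; namespace `Literature.NumberTheory.Rogawski1990`.  THEOREMS ONLY (no definition, no instance, no notation, no named fact, no `sorry`); kernel lane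
`--supports stmt-HodgeConjecture-24833`.  Cell `pub/hodgecm-mathlib`, crux H413; road «S3-tree», T3′ «depth-zero κ-transfer», ROW 2 of the type-(2) socket (R2², holder A-p19 (g26)),
cut 20:05:53Z into (D1)–(D5); THIS FILE = **(D1)** (A-152 → A-p12 (g22)).  In the CM frame at a non-split unramified `v` with CM place `w` (`σ_w` = ★ `galAdicCompletionMap`,
`J = H′_w` = ★ `placeForm H' w.1`), for a `G`-regular type-(2) `γ_H = (g, u) ∈ H_v` (`χ_g` irreducible over `L_w`) and a match `δ ∈ G′_v` (★ `IsLocalNormPair`) whose `w`-avatar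
`τ := δ_w` is residually unipotent, we DELIVER at the one place `w`: the scalars `u = u_w`, `t = tr g_w`, `D = det g_w ∈ 𝒪[L_w]` with `charpoly τ = (X − u)(X² − tX + D)` and
Cayley–Hamilton in (D3)'s cubic tokens, the unitarity identities `σu·u = 1`, `D·σD = 1`, `σt = t·σD` and `ᵗ(στ) placeForm H' w.1 τ = J`, the exponents `|u² − tu + D| = q⁻ⁿ`,
`|t² − 4D| = q^{−(2N+1)}` (restated from the R2² binders), the deepness `|u − 1| < 1`, `|t − 2| < 1`, integrality of `charpoly τ`, `χ_g(u) ≠ 0` and «`χ_g` has no root» in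
(D3)'s shape, a CYCLIC vector `w₀` of `τ` (`det Krylov(τ, w₀)` a unit — `charpoly τ` is square-free), a `u`-EIGENVECTOR `x₀ ≠ 0` with NON-ISOTROPIC hermitian value
`x₀* placeForm H' w.1 x₀ ≠ 0` (`σ`-fixed), and THE κ-READING `κ_v(γ_H, δ) = 1 ↔ ord_w(x₀* placeForm H' w.1 x₀)` even (★ `finKappaAt_eq_ite_of_eigenvector` — the value is a unit norm iff its order is even at an
inert place, ★ `exists_mul_galAdicCompletionMap_mul_eq_one_of_even`).  HONEST LABEL: HC_CM is proved only modulo the 2 remaining named inputs (hLiu418 24832, h413 24833) until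
rung 0 closes; this file discharges no named fact.

## References
* [Rogawski1990] J. D. Rogawski, *Automorphic Representations of Unitary Groups in Three Variables*, Ann. of Math. Stud. 123 (1990): §4.9 Lemma 4.9.3 p. 56, Prop. 4.9.1 (b) p. 55;
  §4.3 (4.3.2) p. 43; §3.5 Prop. 3.5.2 (c) p. 29.
* [Flicker1998UnitaryFL] Y. Z. Flicker, *Elementary proof of the fundamental lemma for a unitary group*, Canad. J. Math. 50 (1998): Props. 16–17 pp. 95–97.
* [LanglandsShelstad1987] R. P. Langlands, D. Shelstad, *On the definition of transfer factors*, Math. Ann. 278 (1987): §1.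
* [SerreLocalFields1979] J.-P. Serre, *Local Fields*, GTM 67 (1979): Ch. V §2 Prop. 3 and Corollary.
* [HornJohnson2013] R. A. Horn, C. R. Johnson, *Matrix Analysis*, 2nd ed. (2013): §3.3 (non-derogatory matrices and cyclic vectors), Thm. 2.4.3.2.
-/

set_option autoImplicit false

noncomputable section

open NumberField IsDedekindDomain Matrix Polynomial
open scoped Matrix MatrixGroups Valued

namespace Literature.NumberTheory.Rogawski1990

open Literature.NumberTheory.Automorphic Literature.NumberTheory.Automorphic.UnitaryGroup
open Literature.NumberTheory.GaloisRepresentations Literature.NumberTheory.NumberFields Literature.NumberTheory.LocalFields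

/-! ## The assembly at the CM place (generic algebra: part 1∕2 `TypeTwoOnePlaceDataAlgebra`) -/

section Assembly

variable (L : Type) [Field L] [NumberField L] [IsCMField L] (H' : Matrix (Fin 3) (Fin 3) L)
  {v : HeightOneSpectrum (𝓞 ↥(maximalRealSubfield L))}

set_option maxHeartbeats 1600000 in  -- ≈ 60 facts assembled against large one-place carrier types (cf. ★ p846592: 1600000)
open scoped Classical in
/-- **(D1) ONE-PLACE DATA OF A TYPE-(2) MATCH.**  See the module docstring: `u = u_w`, `t = tr g_w`, `D = det g_w`; `τ = δ_w`; `σ = σ_w`; `J = H′_w`; outputs in the token order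
dictionary ∕ factorised `charpoly` ∕ Cayley–Hamilton ∕ integrality ∕ `det τ` unit ∕ unitarity of `τ` ∕ `σu·u = 1`, `D·σD = 1`, `σt = t·σD` ∕ exponents `n`, `2N+1` ∕ deepness ∕
`χ_g(u) ≠ 0` ∕ no root ∕ cyclic `w₀` ∕ eigenvector `x₀` ∕ `x₀*Jx₀ ≠ 0`, `σ`-fixed ∕ κ-reading.
[cite: Rogawski1990, §4.9 Lemma 4.9.3 p. 56; §4.3 (4.3.2) p. 43; §3.5 Prop. 3.5.2 (c) p. 29] [cite: Flicker1998UnitaryFL, Props. 16–17 pp. 95–97] [cite: LanglandsShelstad1987, §1] -/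
theorem exists_typeTwo_onePlace_data
    (hH' : (H'.map (IsCMField.complexConj L))ᵀ = H') (w : PlacesOver L v)
    (hw : IsCMField.complexConj L • w.1 = w.1) (hv : Algebra.IsUnramifiedIn (𝓞 L) v.asIdeal)
    (hH'w : IsUnit (placeForm H' w.1))
    {γH : (cmDatum L 2 (Matrix.of fun i j : Fin 2 => if i.val + j.val + 1 = 2 then (1 : L) else 0)).Local v ×
      (cmDatum L 1 (Matrix.of fun i j : Fin 1 => if i.val + j.val + 1 = 1 then (1 : L) else 0)).Local v}
    (hreg : IsLocalGRegular L v γH)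
    (hirr : ¬ ∃ x : w.1.adicCompletion L, (((γH.1.val : GL (Fin 2) (LocalRing L v)).val.map (Pi.evalRingHom (fun w' : PlacesOver L v => w'.1.adicCompletion L) w)).charpoly).IsRoot x)
    (n N : ℕ)
    (hn : Valued.v (((finCharpolyTwo L v γH).eval (finGammaTwo L v γH)) w) = WithZero.exp (-(n : ℤ)))
    (hN : Valued.v (((γH.1.val : GL (Fin 2) (LocalRing L v)).val.map (Pi.evalRingHom (fun w' : PlacesOver L v => w'.1.adicCompletion L) w)).trace ^ 2 - 4 * ((γH.1.val : GL (Fin 2) (LocalRing L v)).val.map (Pi.evalRingHom (fun w' : PlacesOver L v => w'.1.adicCompletion L) w)).det) = WithZero.exp (-((2 * N + 1 : ℕ) : ℤ)))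
    {δ : (cmDatum L 3 H').Local v} (hδ : IsLocalNormPair L H' v γH δ)
    (ht : ∀ m : ℕ, ValuativeRel.valuation (w.1.adicCompletion L) (((((δ.val : GL (Fin 3) (LocalRing L v)).val.map (Pi.evalRingHom (fun w' : PlacesOver L v => w'.1.adicCompletion L) w))).charpoly - (Polynomial.X - 1) ^ 3).coeff m) < 1) :
    ∃ (u t D : w.1.adicCompletion L) (w₀ x₀ : Fin 3 → w.1.adicCompletion L),
      -- dictionary back to the R2² tokens
      u = finGammaTwo L v γH w ∧ t = ((γH.1.val : GL (Fin 2) (LocalRing L v)).val.map (Pi.evalRingHom (fun w' : PlacesOver L v => w'.1.adicCompletion L) w)).trace ∧ D = ((γH.1.val : GL (Fin 2) (LocalRing L v)).val.map (Pi.evalRingHom (fun w' : PlacesOver L v => w'.1.adicCompletion L) w)).det ∧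
      -- integrality
      u ∈ 𝒪[w.1.adicCompletion L] ∧ t ∈ 𝒪[w.1.adicCompletion L] ∧ D ∈ 𝒪[w.1.adicCompletion L] ∧
      -- the factorised characteristic polynomial of `τ = δ_w`, Cayley–Hamilton in (D3)'s cubic tokens, integrality of its coefficients
      ((δ.val : GL (Fin 3) (LocalRing L v)).val.map (Pi.evalRingHom (fun w' : PlacesOver L v => w'.1.adicCompletion L) w)).charpoly = (X - C u) * (X ^ 2 - C t * X + C D) ∧
      aeval ((δ.val : GL (Fin 3) (LocalRing L v)).val.map (Pi.evalRingHom (fun w' : PlacesOver L v => w'.1.adicCompletion L) w)) (C 1 * X ^ 3 + C (-(t + u)) * X ^ 2 + C (D + t * u) * X + C (-(u * D))) = 0 ∧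
      (∀ i : ℕ, ((δ.val : GL (Fin 3) (LocalRing L v)).val.map (Pi.evalRingHom (fun w' : PlacesOver L v => w'.1.adicCompletion L) w)).charpoly.coeff i ∈ 𝒪[w.1.adicCompletion L]) ∧
      -- `τ ∈ U(σ_w, J)(L_w)`
      IsUnit ((δ.val : GL (Fin 3) (LocalRing L v)).val.map (Pi.evalRingHom (fun w' : PlacesOver L v => w'.1.adicCompletion L) w)).det ∧
      (((δ.val : GL (Fin 3) (LocalRing L v)).val.map (Pi.evalRingHom (fun w' : PlacesOver L v => w'.1.adicCompletion L) w)).map (galAdicCompletionMap (L := L) (IsCMField.complexConj L) hw))ᵀ * placeForm H' w.1 * ((δ.val : GL (Fin 3) (LocalRing L v)).val.map (Pi.evalRingHom (fun w' : PlacesOver L v => w'.1.adicCompletion L) w)) = placeForm H' w.1 ∧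
      -- the torus identities
      galAdicCompletionMap (L := L) (IsCMField.complexConj L) hw u * u = 1 ∧ D * galAdicCompletionMap (L := L) (IsCMField.complexConj L) hw D = 1 ∧ galAdicCompletionMap (L := L) (IsCMField.complexConj L) hw t = t * galAdicCompletionMap (L := L) (IsCMField.complexConj L) hw D ∧
      -- the observable exponents and deepness
      Valued.v (u * u - t * u + D) = WithZero.exp (-(n : ℤ)) ∧
      Valued.v (t ^ 2 - 4 * D) = WithZero.exp (-((2 * N + 1 : ℕ) : ℤ)) ∧
      Valued.v (u - 1) < 1 ∧ Valued.v (t - 2) < 1 ∧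
      u * u - t * u + D ≠ 0 ∧ (∀ x : w.1.adicCompletion L, x * x - t * x + D ≠ 0) ∧
      -- a cyclic vector and a `u`-eigenvector
      IsUnit (Matrix.of fun i j : Fin 3 => ((((δ.val : GL (Fin 3) (LocalRing L v)).val.map (Pi.evalRingHom (fun w' : PlacesOver L v => w'.1.adicCompletion L) w)) ^ (j : ℕ)) *ᵥ w₀) i).det ∧
      x₀ ≠ 0 ∧ ((δ.val : GL (Fin 3) (LocalRing L v)).val.map (Pi.evalRingHom (fun w' : PlacesOver L v => w'.1.adicCompletion L) w)) *ᵥ x₀ = u • x₀ ∧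
      -- the hermitian value on the eigenline and the reading of `κ_v`
      (∑ i : Fin 3, ∑ k : Fin 3, galAdicCompletionMap (L := L) (IsCMField.complexConj L) hw (x₀ i) * placeForm H' w.1 i k * x₀ k) ≠ 0 ∧ galAdicCompletionMap (L := L) (IsCMField.complexConj L) hw (∑ i : Fin 3, ∑ k : Fin 3, galAdicCompletionMap (L := L) (IsCMField.complexConj L) hw (x₀ i) * placeForm H' w.1 i k * x₀ k) = (∑ i : Fin 3, ∑ k : Fin 3, galAdicCompletionMap (L := L) (IsCMField.complexConj L) hw (x₀ i) * placeForm H' w.1 i k * x₀ k) ∧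
      (finKappaAt L v H' γH δ = 1 ↔ Even (WithZero.log (Valued.v (∑ i : Fin 3, ∑ k : Fin 3, galAdicCompletionMap (L := L) (IsCMField.complexConj L) hw (x₀ i) * placeForm H' w.1 i k * x₀ k)))) := by
  classical
  -- ABBREVIATIONS: `f = (·)_w`, `σ = σ_w`, `g = g_w`, `τ = δ_w`, `u = u_w`, `t = tr g`, `D = det g`, `J = H′_w`
  set f : LocalRing L v →+* w.1.adicCompletion L := Pi.evalRingHom (fun w' : PlacesOver L v => w'.1.adicCompletion L) w with hfdef
  set σ : w.1.adicCompletion L →+* w.1.adicCompletion L := galAdicCompletionMap (L := L) (IsCMField.complexConj L) hw with hσdef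
  set gR : Matrix (Fin 2) (Fin 2) (LocalRing L v) := (γH.1.val : GL (Fin 2) (LocalRing L v)).val with hgRdef
  set g : Matrix (Fin 2) (Fin 2) (w.1.adicCompletion L) := gR.map f with hgdef
  set τR : Matrix (Fin 3) (Fin 3) (LocalRing L v) := (δ.val : GL (Fin 3) (LocalRing L v)).val with hτRdef
  set τ : Matrix (Fin 3) (Fin 3) (w.1.adicCompletion L) := τR.map f with hτdef
  set u : w.1.adicCompletion L := finGammaTwo L v γH w with hudef
  set t : w.1.adicCompletion L := g.trace with htdef
  set D : w.1.adicCompletion L := g.det with hDdef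
  set J : Matrix (Fin 3) (Fin 3) (w.1.adicCompletion L) := placeForm H' w.1 with hJdef
  -- (0) one place above `v`; reading components at `w`
  have hvss : Subsingleton (PlacesOver L v) :=
    UnitaryGroup.PlacesOver.subsingleton_of_smul_eq (IsCMField.complexConj L) (IsCMField.complexConj_ne_one L) w hw
  have happ : ∀ {y z : LocalRing L v}, y w = z w → y = z := fun {y z} h => funext fun w' => by
    obtain rfl : w' = w := Subsingleton.elim _ _
    exact h
  have hne_w : ∀ {z : LocalRing L v}, z ≠ 0 → z w ≠ 0 := fun {z} hz h0 => hz (happ (by rw [h0]; rfl))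
  -- (1) characteristic polynomials: `χ_g,w = X² − tX + D`, `charpoly τ = (X − u)·χ_g,w`
  have hgcp : g.charpoly = X ^ 2 - C t * X + C D := Matrix.charpoly_fin_two g
  have hfin : finCharpolyTwo L v γH = gR.charpoly := rfl
  have hcp : τ.charpoly = (X - C u) * (X ^ 2 - C t * X + C D) := by
    rw [hτdef, Matrix.charpoly_map, hτRdef, hδ.charpoly_eq, Polynomial.map_mul, Polynomial.map_sub, map_X, map_C, hfin,
      ← Matrix.charpoly_map, ← hgdef, hgcp, mul_comm]
    rfl
  have hcub : τ.charpoly = C 1 * X ^ 3 + C (-(t + u)) * X ^ 2 + C (D + t * u) * X + C (-(u * D)) := by rw [hcp, cubic_tokens_eq]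
  -- (2) the exponent `n`: `χ_g(u)` read at `w`
  have hχeval : ∀ x : w.1.adicCompletion L, (X ^ 2 - C t * X + C D : (w.1.adicCompletion L)[X]).eval x = x * x - t * x + D := fun x => by
    simp only [eval_add, eval_sub, eval_mul, eval_pow, eval_X, eval_C]; ring
  have hn' : Valued.v (u * u - t * u + D) = WithZero.exp (-(n : ℤ)) := by
    have h : (finCharpolyTwo L v γH).eval (finGammaTwo L v γH) w = u * u - t * u + D := by
      show f ((finCharpolyTwo L v γH).eval (finGammaTwo L v γH)) = _
      rw [← eval₂_at_apply, ← eval_map, hfin, ← Matrix.charpoly_map, ← hgdef, hgcp, hχeval]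
      rfl
    rw [← h]; exact hn
  have hχune : u * u - t * u + D ≠ 0 := fun h0 => by
    rw [h0, map_zero] at hn'; exact WithZero.coe_ne_zero hn'.symm
  have hχr : ∀ x : w.1.adicCompletion L, x * x - t * x + D ≠ 0 := fun x hx => hirr ⟨x, by rw [hgcp, IsRoot, hχeval]; exact hx⟩
  have hχu : ¬ (X ^ 2 - C t * X + C D : (w.1.adicCompletion L)[X]).IsRoot u := by rw [IsRoot, hχeval]; exact hχune
  have hχmon : (X ^ 2 - C t * X + C D : (w.1.adicCompletion L)[X]).Monic := hgcp ▸ Matrix.charpoly_monic g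
  have hχdeg : (X ^ 2 - C t * X + C D : (w.1.adicCompletion L)[X]).natDegree = 2 := by
    rw [← hgcp, Matrix.charpoly_natDegree_eq_dim, Fintype.card_fin]
  have hχirr : Irreducible (X ^ 2 - C t * X + C D : (w.1.adicCompletion L)[X]) := by
    refine (hχmon.irreducible_iff_roots_eq_zero_of_degree_le_three (by rw [hχdeg]) (by rw [hχdeg]; norm_num)).2 ?_
    refine Multiset.eq_zero_of_forall_notMem fun x hx => hχr x ?_
    rw [mem_roots hχmon.ne_zero, IsRoot, hχeval] at hx
    exact hx
  -- (3) deepness: `charpoly τ ≡ (X − 1)³`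
  have hiso := ValuativeRel.isEquiv (ValuativeRel.valuation (w.1.adicCompletion L)) (Valued.v : Valuation (w.1.adicCompletion L) (WithZero (Multiplicative ℤ)))
  have h1cp : (Polynomial.X - 1 : (w.1.adicCompletion L)[X]) ^ 3 = (1 : Matrix (Fin 3) (Fin 3) (w.1.adicCompletion L)).charpoly := by
    rw [Matrix.charpoly_one, Fintype.card_fin]
  have hdeep : ∀ i < 3, Valued.v (τ.charpoly.coeff i - (1 : Matrix (Fin 3) (Fin 3) (w.1.adicCompletion L)).charpoly.coeff i) < 1 := fun i _ => by
    have h := (hiso.lt_one_iff_lt_one).1 (ht i)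
    rwa [h1cp, coeff_sub] at h
  have hint' : ∀ i : ℕ, τ.charpoly.coeff i ∈ 𝒪[w.1.adicCompletion L] := fun i =>
    (Valuation.mem_integer_iff _ _).2 (v_charpoly_coeff_le_one_of_residuallyUnipotent τ hdeep i)
  have hu1 : Valued.v (u - 1) < 1 :=
    valuation_sub_one_lt_one_of_isRoot_charpoly_of_residuallyUnipotent τ hdeep
      (by rw [hcp, IsRoot, eval_mul, eval_sub, eval_X, eval_C, sub_self, zero_mul])
  have hs3 : Valued.v (t + u - 3) < 1 := by
    have h := hdeep 2 (by norm_num)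
    rw [hcp, coeff_two_cubic, coeff_two_charpoly_one, show (-(t + u) - -3 : w.1.adicCompletion L) = -(t + u - 3) by ring,
      Valuation.map_neg] at h
    exact h
  have ht2 : Valued.v (t - 2) < 1 := by
    rw [show t - 2 = (t + u - 3) - (u - 1) by ring]
    exact lt_of_le_of_lt (Valuation.map_sub _ _ _) (max_lt hs3 hu1)
  have huO : u ∈ 𝒪[w.1.adicCompletion L] := by
    refine (Valuation.mem_integer_iff _ _).2 ?_
    have h := Valuation.map_add Valued.v (u - 1) 1
    rw [sub_add_cancel, map_one] at h
    exact h.trans (max_le hu1.le le_rfl)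
  have h2le : Valued.v (2 : w.1.adicCompletion L) ≤ 1 := by
    have h := Valuation.map_add Valued.v (1 : w.1.adicCompletion L) 1
    rw [map_one, max_self, one_add_one_eq_two] at h
    exact h
  have htO : t ∈ 𝒪[w.1.adicCompletion L] := by
    refine (Valuation.mem_integer_iff _ _).2 ?_
    have h := Valuation.map_add Valued.v (t - 2) 2
    rw [sub_add_cancel] at h
    exact h.trans (max_le ht2.le h2le)
  have hDO : D ∈ 𝒪[w.1.adicCompletion L] := by
    have h1 : τ.charpoly.coeff 1 = D + t * u := by rw [hcp, coeff_one_cubic]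
    have h : D = τ.charpoly.coeff 1 - t * u := by rw [h1]; ring
    rw [h]
    exact Subring.sub_mem _ (hint' 1) (Subring.mul_mem _ htO huO)
  -- (4) the torus identities
  have hσu : σ u * u = 1 := map_finGammaTwo_mul_finGammaTwo L v w hw γH
  have hgunit : (g.map σ)ᵀ * (!![0, 1; 1, 0] : Matrix (Fin 2) (Fin 2) (w.1.adicCompletion L)) * g = !![0, 1; 1, 0] := by
    have h := transpose_map_fst_evalRingHom_mul L v w hw γH
    rw [UnitaryGroup.placeForm_antidiagTwo_eq_antidiag L v w] at h
    exact h
  have hDσ : D * σ D = 1 := det_mul_map_det_eq_one_of_unitary_antidiag σ g hgunit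
  have hσt : σ t = t * σ D := by
    have h := map_trace_mul_det_eq_trace_of_unitary_antidiag σ g hgunit
    calc σ t = σ t * (D * σ D) := by rw [hDσ, mul_one]
      _ = σ t * D * σ D := by ring
      _ = t * σ D := by rw [h]
  -- (5) `τ ∈ U(σ, J)`, `det τ` a unit, Cayley–Hamilton
  have h11 : (τ.map σ)ᵀ * J * τ = J :=
    (UnitaryGroup.localNonsplitEquiv (IsCMField.complexConj L) H' (IsCMField.complexConj_ne_one L) w hw δ).2
  have h10 : IsUnit τ.det := by
    have h := (Matrix.isUnits_det_units (δ.val : GL (Fin 3) (LocalRing L v))).map f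
    rw [RingHom.map_det] at h
    exact h
  have hCH : aeval τ (C 1 * X ^ 3 + C (-(t + u)) * X ^ 2 + C (D + t * u) * X + C (-(u * D))) = 0 := by
    rw [← hcub]; exact Matrix.aeval_self_charpoly τ
  -- (6) the eigenline: `P_v = p qᵀ`, a non-zero column `x₀ = q_j • p` is a `u`-eigenvector
  obtain ⟨pR, qR, hPR⟩ := finEigenlineProjector_eq_vecMulVec_of_isLocalNormPair L v H' γH δ hδ
  have hPne := finEigenlineProjector_ne_zero L v H' γH δ hδ hreg
  obtain ⟨i₀, j, hij⟩ : ∃ i j : Fin 3, finEigenlineProjector L v H' γH δ i j ≠ 0 := by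
    by_contra h
    push Not at h
    exact hPne (Matrix.ext fun i j => by rw [h i j]; rfl)
  set x₀R : Fin 3 → LocalRing L v := fun i => finEigenlineProjector L v H' γH δ i j with hx₀Rdef
  have hx₀R : τR *ᵥ x₀R = finGammaTwo L v γH • x₀R := localMatrix_mulVec_finEigenlineProjector_col L v H' γH δ hδ j
  have hx₀Rne : x₀R ≠ 0 := fun h0 => hij (congrFun h0 i₀)
  set p : Fin 3 → w.1.adicCompletion L := fun i => f (pR i) with hpdef
  set q : Fin 3 → w.1.adicCompletion L := fun i => f (qR i) with hqdef
  set x₀ : Fin 3 → w.1.adicCompletion L := fun i => p i * q j with hx₀def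
  have hx₀f : ∀ i, f (x₀R i) = x₀ i := fun i => by
    simp only [hx₀Rdef, hPR, Matrix.vecMulVec_apply, map_mul, hx₀def, hpdef, hqdef]
  have hx₀ : τ *ᵥ x₀ = u • x₀ := by
    funext i
    have h := congrArg f (congrFun hx₀R i)
    rw [RingHom.map_mulVec, Pi.smul_apply, smul_eq_mul, map_mul] at h
    have hfx : (f ∘ x₀R) = x₀ := funext hx₀f
    rw [hfx, hx₀f] at h
    rw [h, Pi.smul_apply, smul_eq_mul, hudef]
    rfl
  have hx₀ne : x₀ ≠ 0 := fun h0 => hne_w hij (by have h := hx₀f i₀; rw [h0, Pi.zero_apply] at h; exact h)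
  -- `P_v` read at `w`
  have hPdef : finEigenlineProjector L v H' γH δ = τR * τR - gR.trace • τR + gR.det • (1 : Matrix (Fin 3) (Fin 3) (LocalRing L v)) := rfl
  have htrf : f gR.trace = t := by
    simp only [htdef, hgdef, Matrix.trace, Matrix.diag, map_sum, Matrix.map_apply]
  have hdetf : f gR.det = D := by rw [hDdef, hgdef, RingHom.map_det]; rfl
  have hPτ : τ * τ - t • τ + D • (1 : Matrix (Fin 3) (Fin 3) (w.1.adicCompletion L)) = Matrix.vecMulVec p q := by
    have h := congrArg (fun M : Matrix (Fin 3) (Fin 3) (LocalRing L v) => M.map f) hPR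
    simp only [hPdef] at h
    rw [Matrix.map_add f (map_add f), Matrix.map_sub f (map_sub f), Matrix.map_mul, Matrix.map_smul' f _ _ (map_mul f),
      Matrix.map_smul' f _ _ (map_mul f), Matrix.map_one f (map_zero f) (map_one f), htrf, hdetf] at h
    rw [h]
    ext i k
    simp [Matrix.vecMulVec_apply, Matrix.map_apply, hpdef, hqdef]
  -- (7) the hermitian value on the eigenline: non-zero and `σ`-fixed
  have hJdet : J.det ≠ 0 := ((Matrix.isUnit_iff_isUnit_det _).1 hH'w).ne_zero
  have hS0 : ∑ i : Fin 3, ∑ k : Fin 3, σ (x₀ i) * J i k * x₀ k ≠ 0 :=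
    hermitian_value_eigenvector_ne_zero σ J τ hJdet h11 hσu hχune hPτ j hx₀ne hx₀
  have hH'c : (H'.map (cmConjRingHom L))ᵀ = H' := by
    have e1 : H'.map (cmConjRingHom L) = H'.map (IsCMField.complexConj L) := by
      ext i k; simp [Matrix.map_apply, cmConjRingHom_apply]
    rw [e1]; exact hH'
  have hσσ : ∀ a : w.1.adicCompletion L, σ (σ a) = a := galAdicCompletionMap_involutive L v w hw
  have hJh : ∀ i k, σ (J i k) = J k i := fun i k => by
    have h := congrFun (congrFun (placeForm_map_transpose_of_hermitian L v w hw H' hH'c) k) i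
    rw [Matrix.transpose_apply, Matrix.map_apply] at h
    exact h
  have hσS : σ (∑ i : Fin 3, ∑ k : Fin 3, σ (x₀ i) * J i k * x₀ k) = ∑ i : Fin 3, ∑ k : Fin 3, σ (x₀ i) * J i k * x₀ k := by
    simp only [map_sum, map_mul, hσσ, hJh]
    rw [Finset.sum_comm]
    exact Finset.sum_congr rfl fun _ _ => Finset.sum_congr rfl fun _ _ => by ring
  -- (8) the reading of `κ_v`
  have hu' : IsUnit ((finCharpolyTwo L v γH).eval (finGammaTwo L v γH)) := isUnit_eval_finCharpolyTwo_of_isLocalGRegular L v γH hreg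
  have hκ := finKappaAt_eq_ite_of_eigenvector L v H' γH δ hvss hδ hu' hx₀R hx₀Rne
  have hJw : ∀ i k, ((UnitaryGroup.adelicForm L 3 H').map (UnitaryGroup.adeleToLocal L v)) i k w = J i k := fun i k => by
    rw [UnitaryGroup.adelicForm_map_adeleToLocal]; rfl
  have hconj : ∀ z : LocalRing L v, UnitaryGroup.conjLocal L (IsCMField.complexConj L) v z w = σ (z w) := fun z =>
    UnitaryGroup.conjLocal_apply_eq_of_smul_eq (IsCMField.complexConj L) (IsCMField.complexConj_ne_one L) v w hw z
  have hSR : (∑ i : Fin 3, ∑ k : Fin 3, UnitaryGroup.conjLocal L (IsCMField.complexConj L) v (x₀R i) *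
      ((UnitaryGroup.adelicForm L 3 H').map (UnitaryGroup.adeleToLocal L v)) i k * x₀R k) w =
      ∑ i : Fin 3, ∑ k : Fin 3, σ (x₀ i) * J i k * x₀ k := by
    simp only [Finset.sum_apply, Pi.mul_apply, hconj, hJw]
    refine Finset.sum_congr rfl fun i _ => Finset.sum_congr rfl fun k _ => ?_
    rw [show x₀R i w = f (x₀R i) from rfl, show x₀R k w = f (x₀R k) from rfl, hx₀f, hx₀f]
  have h26 : (finKappaAt L v H' γH δ = 1 ↔ Even (WithZero.log (Valued.v (∑ i : Fin 3, ∑ k : Fin 3, σ (x₀ i) * J i k * x₀ k)))) := by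
    constructor
    · intro hκ1
      by_cases hc : ∃ z : LocalRing L v, IsUnit z ∧
          (∑ i : Fin 3, ∑ k : Fin 3, UnitaryGroup.conjLocal L (IsCMField.complexConj L) v (x₀R i) *
            ((UnitaryGroup.adelicForm L 3 H').map (UnitaryGroup.adeleToLocal L v)) i k * x₀R k) =
          z * UnitaryGroup.conjLocal L (IsCMField.complexConj L) v z
      · obtain ⟨z, -, hSz⟩ := hc
        have hSw := congrFun hSz w
        rw [hSR, Pi.mul_apply, hconj] at hSw
        have hzw : z w ≠ 0 := fun h0 => hS0 (by rw [hSw, h0, zero_mul])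
        have hvz : Valued.v (z w) ≠ 0 := (Valuation.ne_zero_iff _).2 hzw
        rw [hSw, map_mul, valued_galAdicCompletionMap, WithZero.log_mul hvz hvz]
        exact ⟨_, rfl⟩
      · rw [hκ, if_neg hc] at hκ1
        norm_num at hκ1
    · intro heven
      obtain ⟨a, ha⟩ := exists_mul_galAdicCompletionMap_mul_eq_one_of_even L v w hw hv _ hS0 hσS heven
      have ha0 : a ≠ 0 := fun h0 => by rw [h0, zero_mul, zero_mul] at ha; exact zero_ne_one ha
      have hSval : ∑ i : Fin 3, ∑ k : Fin 3, σ (x₀ i) * J i k * x₀ k = a⁻¹ * σ a⁻¹ := by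
        rw [(inv_eq_of_mul_eq_one_right ha).symm, mul_inv, map_inv₀]
      set z : LocalRing L v := Function.update (0 : LocalRing L v) w a⁻¹ with hzdef
      have hzw : z w = a⁻¹ := by rw [hzdef, Function.update_self]
      have hz0 : z ≠ 0 := fun h0 => by
        have h := congrFun h0 w
        rw [hzw] at h
        exact inv_ne_zero ha0 h
      have hzu : IsUnit z := isUnit_localRing_of_ne_zero_of_subsingleton L v hvss hz0
      have hSz : (∑ i : Fin 3, ∑ k : Fin 3, UnitaryGroup.conjLocal L (IsCMField.complexConj L) v (x₀R i) *
            ((UnitaryGroup.adelicForm L 3 H').map (UnitaryGroup.adeleToLocal L v)) i k * x₀R k) =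
          z * UnitaryGroup.conjLocal L (IsCMField.complexConj L) v z :=
        happ (by rw [hSR, Pi.mul_apply, hconj, hzw, hSval])
      rw [hκ, if_pos ⟨z, hzu, hSz⟩]
  -- (9) a cyclic vector
  obtain ⟨a, ha⟩ := exists_mulVec_ne_smul_of_charpoly τ hχu hcp
  have hcyc : ∃ w₀ : Fin 3 → w.1.adicCompletion L, IsUnit (Matrix.of fun i j : Fin 3 => ((τ ^ (j : ℕ)) *ᵥ w₀) i).det := by
    by_cases hχa : aeval τ (X ^ 2 - C t * X + C D : (w.1.adicCompletion L)[X]) *ᵥ a = 0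
    · refine ⟨a + x₀, isUnit_det_krylov_of_not_eigen_of_aeval_ne τ hχirr hχdeg hcp ?_ ?_⟩
      · intro h
        rw [Matrix.mulVec_add, hx₀, smul_add] at h
        exact ha (add_right_cancel h)
      · rw [Matrix.mulVec_add, hχa, zero_add, aeval_quadratic_mulVec_of_eigenvector τ t D hx₀]
        exact smul_ne_zero hχune hx₀ne
    · exact ⟨a, isUnit_det_krylov_of_not_eigen_of_aeval_ne τ hχirr hχdeg hcp ha hχa⟩
  obtain ⟨w₀, hw₀⟩ := hcyc
  exact ⟨u, t, D, w₀, x₀, rfl, rfl, rfl, huO, htO, hDO, hcp, hCH, hint', h10, h11, hσu, hDσ, hσt, hn', hN, hu1, ht2, hχune, hχr, hw₀,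
    hx₀ne, hx₀, hS0, hσS, h26⟩

end Assembly

end Literature.NumberTheory.Rogawski1990

end
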